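import Literature.Probability.RandomPlanarGeometry.HexSAWSurfaceWallRenewalEightUnique
import Literature.Probability.RandomPlanarGeometry.HexSAWSurfaceFourthOrderUpper
import HarnessLib

/-!
# The renewal mean to THIRD order, exactly: `y³ (m(y) − 1 − 2y/β(y)⁶) → 3`, i.e. `m(y) = 1 + 2/y² + 3/y³ + o(y⁻³)`;
# the order-three analytic census: every irreducible positive wall bridge of length `n ≥ 10` has at most `n/2 − 4` visits
# (`N₅₂ = N₆₃ = N₇₄ = 0`), `Λ₁₀(y) = N₅₁·y`, `f₅(y) = N₅₁·y/β(y)¹⁰`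

Topic `Literature/Probability/RandomPlanarGeometry` (lane «pcv-sawmu», a-idea-1 g31, car «THIRD-EXACT»; parents: the pool cars
«EIGHT-UNIQUE» `HexSAWSurfaceWallRenewalEightUnique.lean` (`pwbLaw_four_eq : f₄ = y/β⁸`, `card_ipwb_eight_eq_one : N₄₁ = 1`), through it
«THIRD-LOWER-MEAN» (`three_mul_le_cube_mul`, `tendsto_pow_four_div_wallRate_pow_eight`, `three_le_of_tendsto_cube_mul`: IF the third-order
limit `L` exists THEN `3 ≤ L` — this file proves it exists and equals `3`) and «EXCESS-LIMIT» (`hasSum_excess_tail`, `pwbLaw_three`,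
`visits_le_two_of_mem_ipwb_ten`, `card_ipwb_le_three_pow`, the order-two census whose method — Kesten's identity `Σ_s f_s(y) = 1` evaluated at ONE
large fugacity — is repeated here one order up); and the tree's FOURTH-ORDER UPPER WINDOW `HexSAWSurfaceFourthOrderUpper.wallRate_sq_le_fourth`
(`β(y)² ≤ y + 1/y + 1/y² + 2/y³ + 708591/y⁴`, `y ≥ 36`), `HexSAWSurfaceWallRenewal` (`pwb`, `ipwb`, `IPWB`, `pwbLaw`, `pwbMean`, `hasSum_pwbLaw`,
`pwbLaw_le_geom`, the entropy bound `four_mul_visits_le : 4·visits ≤ n + 2`), `HexSAWSurfaceSecondOrderSharp.wallRate_sq_le_sharp`,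
`HexSAWSurfaceSqrtAsymptotic.sqrt_le_wallRate`).

Sources (primary; identifiers verbatim, no quotation marks).  N. Madras, G. Slade, *The Self-Avoiding Walk*, Birkhäuser 1993: Section 1.2,
(1.2.3) and Definition 1.2.4; Section 4.2, Definition 4.2.1, (4.2.2)–(4.2.5) and Theorem 4.2.2 (pp. 91–92), remark before (4.2.21) (p. 94).
H. Kesten, J. Math. Phys. 4 (1963) 960, Section 4 (irreducible bridges, `Σ_n λ_n μ^{-n} = 1`).  W. Feller, *An Introduction to Probability
Theory and Its Applications* I (3rd ed. 1968), XIII.3 (renewal equation, mean recurrence time).  I. G. Enting, I. Jensen, LNP 775 (2009),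
Section 7.4.2, Fig. 7.10 (brickwork form of the honeycomb lattice).  E. J. Janse van Rensburg, *The Statistical Mechanics of Interacting Walks,
Polygons, Animals and Vesicles*, OUP 2000, Section 3.3.2, Lemma 3.20.  N. R. Beaton, M. Bousquet-Mélou, J. de Gier, H. Duminil-Copin,
A. J. Guttmann, CMP 326 (2014) = arXiv:1109.0358v5, Section 3.1, Proposition 5 (p. 9: `μ(y) ≥ √y`).  H. Duminil-Copin, S. Smirnov,
Ann. Math. 175 (2012), Theorem 1 (`μ = √(2+√2)`).

## What is proved (namespace `…SAW.HexBW.Wall`; block lengths symbolic, `{m} (hm : m = 10)` etc.)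

* §1 (private) the ROOM LEMMA at `y = 10⁶`: the three known blocks — atom `f₁ ≥ y/β²`, dip `f₃ = y/β⁶`, flat excursion `f₄ = y/β⁸`
  (`N₄₁ = 1`) — and the fourth-order upper window leave room `< 10⁻²⁰` in Kesten's identity `Σ_s f_s = 1`
  (`1 − y/β² − y/β⁶ − y/β⁸ = (a₃ + 2)/y⁴ + O(y⁻⁵)` with `a₃ ≤ 2 + 708591/y`).
* §2 ★★ THE ORDER-THREE CENSUS.  `visits_eq_one_of_mem_ipwb_ten` (every irreducible positive wall bridge of length `10` has EXACTLY ONE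
  visit: `N₅₂ = 0`), `visits_le_two_of_mem_ipwb_twelve` (`N₆₃ = 0`), `visits_le_three_of_mem_ipwb_fourteen` (`N₇₄ = 0`) — a class
  `(s, v)` with `v ≥ s − 3` would add `≥ y^{s−3}/β^{2s} ≈ y⁻³·10⁰ = 10⁻¹⁸ ≫ 10⁻²⁰`; with the entropy bound `4v ≤ 2s + 2` for `s ≥ 8`:
  ★★ `two_mul_visits_add_eight_le (hn : 10 ≤ n) (hω : ω ∈ ipwb n) : 2·visits + 8 ≤ n` — EVERY irreducible block of half-length
  `s ≥ 5` has at most `s − 4` visits.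
* §3 ★★ `IPWB_ten : Λ₁₀(y) = #(ipwb 10)·y`, `pwbLaw_five : f₅(y) = #(ipwb 10)·y/β(y)¹⁰`, `IPWB_twelve_le : Λ₁₂ ≤ #(ipwb 12)·y²`,
  `IPWB_fourteen_le : Λ₁₄ ≤ #(ipwb 14)·y³` (`y ≥ 1`), `pwbLaw_le_card_div_pow_four : f_s ≤ #(ipwb 2s)/y⁴` (`s ≥ 5`, `y ≥ 1`),
  `head_four_mul_pwbLaw_le : 4f₅ + 5f₆ + 6f₇ ≤ 31591215/y⁴`.
* §4 `hasSum_excess_tail_eight : Σ_j (j+7) f_{j+8} = m − 1 − (2f₃ + 3f₄ + 4f₅ + 5f₆ + 6f₇)`, ★★ `excess_tail_eight_le (48 ≤ y) : … ≤ 16 μ¹⁸/(y³√y)`,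
  ★★ `cube_mul_pwbMean_sub_one_sub_le (48 ≤ y) : y³(m − 1 − 2y/β⁶) ≤ 3·(y⁴/β⁸) + 31591215/y + 16 μ¹⁸/√y`.
* §5 ★★★ **`tendsto_cube_mul_pwbMean_sub_one_sub : y³ (m(y) − 1 − 2y/β(y)⁶) → 3`** (the flat excursion carries the WHOLE third order;
  with «THIRD-LOWER-MEAN»'s lower bound `3·y⁴/β⁸ ≤ …`), ★★★ `tendsto_cube_mul_pwbMean_sub_one_sub_two_div_sq : y³ (m(y) − 1 − 2/y²) → 3`
  (`2y/β⁶ = 2/y² − 6/y⁴ + O(y⁻⁵)` by `y ≤ β² ≤ y + 8749/y`), i.e. **`m(y) = 1 + 2/y² + 3/y³ + o(y⁻³)`**, and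
  ★ `isEquivalent_pwbMean_sub_one_sub_two_div_sq : m(y) − 1 − 2/y² ∼ 3/y³`.

NOT claimed: the VALUE `N₅₁ = #(ipwb 10)` (a brute-force census gives `3`; the classification of one-visit blocks of length ten is not
done here), hence not the fourth-order coefficient `4N₅₁ + 5N₆₂` of `m − 1`; nothing for `y ≤ μ⁴`; no statement about BBdGDCG's `μ(y)`
beyond what the parents give.
-/

namespace Literature.Probability.RandomPlanarGeometry.SAW.HexBW.Wall

open Finset Filter Function
open Literature.Probability.LatticeModels
open _root_.Topology Asymptotics

variable {y : ℝ} {n : ℕ} {ω : ℕ → Site 2}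

/-! ### §0  Private helpers: `μ`, the block law as `Λ_{2s}/(β²)^s`, Kesten partial sums on `{1, 3, 4, s}` -/

/-- `μ² = 2 + √2`. [cite: DuminilCopinSmirnov2012, Theorem 1] -/
private theorem mu_sq_te : hexConnectiveConstant ^ 2 = 2 + Real.sqrt 2 := by
  rw [hexConnectiveConstant_eq_inv, inv_pow]; exact inv_eq_of_mul_eq_one_right hexCriticalFugacity_sq

/-- `4 ≤ μ⁴`. [cite: DuminilCopinSmirnov2012, Theorem 1] -/
private theorem four_le_mu_four_te : 4 ≤ hexConnectiveConstant ^ 4 := by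
  have h2 : 0 ≤ Real.sqrt 2 := Real.sqrt_nonneg 2
  calc (4 : ℝ) ≤ (2 + Real.sqrt 2) ^ 2 := by nlinarith
    _ = hexConnectiveConstant ^ 4 := by rw [← mu_sq_te]; ring

/-- `μ⁴ < 12`. [cite: DuminilCopinSmirnov2012, Theorem 1] -/
private theorem mu_four_lt_twelve_te : hexConnectiveConstant ^ 4 < 12 := by
  have hup : Real.sqrt 2 ≤ 1.41422 := by
    rw [show (1.41422 : ℝ) = Real.sqrt (1.41422 ^ 2) by rw [Real.sqrt_sq (by norm_num)]]
    exact Real.sqrt_le_sqrt (by norm_num)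
  have h2 : 0 ≤ Real.sqrt 2 := Real.sqrt_nonneg 2
  calc hexConnectiveConstant ^ 4 = (hexConnectiveConstant ^ 2) ^ 2 := by ring
    _ = (2 + Real.sqrt 2) ^ 2 := by rw [mu_sq_te]
    _ ≤ (2 + 1.41422) ^ 2 := by gcongr
    _ < 12 := by norm_num

/-- `μ⁴ < 10⁶`. [cite: DuminilCopinSmirnov2012, Theorem 1] -/
private theorem mu_four_lt_Y_te : hexConnectiveConstant ^ 4 < 1000000 := mu_four_lt_twelve_te.trans (by norm_num)

/-- `y ≤ β(y)²` (`β ≥ √y`). [cite: BeatonBousquetMelouDeGierDuminilCopinGuttmann2014, Section 3.1, Proposition 5 (arXiv v5 p. 9)] -/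
private theorem le_sq_wallRate_te (hy : 0 < y) : y ≤ wallRate y ^ 2 := by
  have h := pow_le_pow_left₀ (Real.sqrt_nonneg y) (sqrt_le_wallRate hy) 2
  rwa [Real.sq_sqrt hy.le] at h

/-- `y^k ≤ β(y)^{2k}`. [cite: BeatonBousquetMelouDeGierDuminilCopinGuttmann2014, Section 3.1, Proposition 5 (arXiv v5 p. 9)] -/
private theorem pow_le_wallRate_pow_te (hy : 0 < y) (k : ℕ) : y ^ k ≤ wallRate y ^ (2 * k) := by
  rw [pow_mul]; exact pow_le_pow_left₀ hy.le (le_sq_wallRate_te hy) k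

/-- `f_s(y) = Λ_{2s}(y)/(β(y)²)^s`. [cite: MadrasSlade1993, Section 4.2, (4.2.2) (p. 91)] -/
private theorem pwbLaw_eq_te (y : ℝ) (s : ℕ) : pwbLaw y s = IPWB (2 * s) y / (wallRate y ^ 2) ^ s := by
  rw [pwbLaw, pow_mul]

/-- A single irreducible block bounds `f_s` from below. [cite: MadrasSlade1993, Section 4.2, (4.2.2) (p. 91)] -/
private theorem single_div_le_pwbLaw_te (hy : 0 ≤ y) {s n : ℕ} (hn : 2 * s = n) (hω : ω ∈ ipwb n) :
    y ^ visits n ω / (wallRate y ^ 2) ^ s ≤ pwbLaw y s := by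
  subst hn
  rw [pwbLaw_eq_te]
  exact div_le_div_of_nonneg_right (Finset.single_le_sum (fun _ _ => pow_nonneg hy _) hω) (pow_nonneg (sq_nonneg _) _)

/-- Kesten partial sums: `Σ_{s ∈ S} f_s(y) ≤ 1` for `y > μ⁴`. [cite: MadrasSlade1993, Section 4.2, (4.2.4) and Theorem 4.2.2 (pp. 91–92)] [cite: Kesten1963SAW, Section 4] -/
private theorem sum_pwbLaw_le_one_te (hy : hexConnectiveConstant ^ 4 < y) (S : Finset ℕ) : ∑ s ∈ S, pwbLaw y s ≤ 1 := by
  have hy0 : 0 ≤ y := by have := four_le_mu_four_te; linarith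
  exact sum_le_hasSum S (fun s _ => pwbLaw_nonneg hy0 s) (hasSum_pwbLaw hy)

/-- Kesten partial sum on `{1, 3, 4, s}`. [cite: MadrasSlade1993, Section 4.2, (4.2.4) (p. 91)] [cite: Kesten1963SAW, Section 4] -/
private theorem kesten_four_te (hy : hexConnectiveConstant ^ 4 < y) {s : ℕ} (hs1 : s ≠ 1) (hs3 : s ≠ 3) (hs4 : s ≠ 4) :
    pwbLaw y 1 + (pwbLaw y 3 + (pwbLaw y 4 + pwbLaw y s)) ≤ 1 := by
  have h := sum_pwbLaw_le_one_te hy {1, 3, 4, s}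
  have h1 : (1 : ℕ) ∉ ({3, 4, s} : Finset ℕ) := by
    simp only [Finset.mem_insert, Finset.mem_singleton]; omega
  have h3 : (3 : ℕ) ∉ ({4, s} : Finset ℕ) := by
    simp only [Finset.mem_insert, Finset.mem_singleton]; omega
  have h4 : (4 : ℕ) ∉ ({s} : Finset ℕ) := by
    simp only [Finset.mem_singleton]; omega
  rwa [Finset.sum_insert h1, Finset.sum_insert h3, Finset.sum_insert h4, Finset.sum_singleton] at h

/-- Every irreducible positive wall bridge visits the surface at least once (its endpoint). [cite: MadrasSlade1993, Section 4.2, Definition 4.2.1 (p. 91)]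
[cite: BeatonBousquetMelouDeGierDuminilCopinGuttmann2014, Section 3.1 (arXiv v5 p. 8: contacts with the surface)] -/
private theorem one_le_visits_te (hω : ω ∈ ipwb n) : 1 ≤ visits n ω := by
  classical
  obtain ⟨hp, hn1, -⟩ := mem_ipwb.1 hω
  obtain ⟨hw, -⟩ := mem_pwb.1 hp
  obtain ⟨ha, -⟩ := mem_wbr.1 hw
  obtain ⟨-, hn2, hYn⟩ := mem_archs.1 ha
  obtain ⟨k, rfl⟩ : ∃ k, n = k + 1 := ⟨n - 1, by omega⟩
  rw [visits_succ, if_pos ⟨hn2, hYn⟩]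
  omega

/-- The length of an irreducible positive wall bridge is even (it is an arch). [cite: MadrasSlade1993, Section 1.2, Definition 1.2.4] -/
private theorem even_len_te (hω : ω ∈ ipwb n) : n % 2 = 0 := by
  obtain ⟨hp, -, -⟩ := mem_ipwb.1 hω
  obtain ⟨hw, -⟩ := mem_pwb.1 hp
  obtain ⟨ha, -⟩ := mem_wbr.1 hw
  exact (mem_archs.1 ha).2.1

/-- `f₁(y) ≥ y/β²` (the atom `(0,0) → (1,0) → (2,0)`; private twin, for `0 ≤ y`, of the tree's
`HexSAWSurfaceWallRenewalMean.div_sq_wallRate_le_pwbLaw_one`, which this file does not import). [cite: MadrasSlade1993, Section 4.2, (4.2.2) (p. 91)]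
[cite: BeatonBousquetMelouDeGierDuminilCopinGuttmann2014, Section 3.1 (arXiv v5 p. 9: walks sticking to the surface)] -/
private theorem div_sq_wallRate_le_pwbLaw_one_te (hy : 0 ≤ y) : y / wallRate y ^ 2 ≤ pwbLaw y 1 := by
  obtain ⟨m, hm⟩ : ∃ m : ℕ, m = 2 * 1 := ⟨_, rfl⟩
  have h := straightWalk_mem_pwb 1
  rw [← hm] at h
  have hmem : Zd.straightWalk 2 m ∈ ipwb m := by
    rw [mem_ipwb]
    refine ⟨h.1, by omega, fun k hk1 hk2 hr => ?_⟩
    have hk : k % 2 = 0 := hr.2.1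
    omega
  have h1 := single_div_le_pwbLaw_te (s := 1) (n := m) hy (by omega) hmem
  rw [h.2, pow_one, pow_one] at h1
  exact h1

/-! ### §1  The room left by the THREE known blocks at `y = 10⁶` is below `10⁻²⁰` (fourth-order upper window) -/

/-- **Room lemma (order three).**  At `y = 10⁶`: if `y/β² + (y/β⁶ + (y/β⁸ + x)) ≤ 1` then `x < 10⁻²⁰` — from `y ≤ β²` and the
fourth-order upper window `β² ≤ y + 1/y + 1/y² + 2/y³ + 708591/y⁴`: the three known blocks leave `1 − y/β² − y/β⁶ − y/β⁸ ≤ 7/y⁴`.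
[cite: MadrasSlade1993, Section 4.2, (4.2.4) (p. 91)] [cite: BeatonBousquetMelouDeGierDuminilCopinGuttmann2014, Section 3.1, Proposition 5] -/
private theorem no_room_te {x : ℝ} (hx : (1 / 10 ^ 20 : ℝ) ≤ x)
    (h : 1000000 / wallRate 1000000 ^ 2 + (1000000 / wallRate 1000000 ^ 6 + (1000000 / wallRate 1000000 ^ 8 + x)) ≤ 1) :
    False := by
  have e6 : wallRate 1000000 ^ 6 = (wallRate 1000000 ^ 2) ^ 3 := by rw [← pow_mul]
  have e8 : wallRate 1000000 ^ 8 = (wallRate 1000000 ^ 2) ^ 4 := by rw [← pow_mul]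
  rw [e6, e8] at h
  set B := wallRate 1000000 ^ 2 with hB
  have hlo : (1000000 : ℝ) ≤ B := le_sq_wallRate_te (by norm_num)
  have hhi : B ≤ 1000000 + 1 / 1000000 + 1 / 1000000 ^ 2 + 2 / 1000000 ^ 3 + 708591 / 1000000 ^ 4 :=
    wallRate_sq_le_fourth (by norm_num)
  have hB0 : 0 < B := by linarith
  have hd : B - 1000000 ≤ 1 / 10 ^ 6 + 1 / 10 ^ 12 + 3 / 10 ^ 18 := by
    have hnum : (1000000 : ℝ) + 1 / 1000000 + 1 / 1000000 ^ 2 + 2 / 1000000 ^ 3 + 708591 / 1000000 ^ 4 ≤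
        1000000 + (1 / 10 ^ 6 + 1 / 10 ^ 12 + 3 / 10 ^ 18) := by norm_num
    linarith
  have hd0 : 0 ≤ B - 1000000 := by linarith
  have hx0 : 0 ≤ x := le_trans (by norm_num) hx
  have key : 1000000 * B ^ 3 + 1000000 * B + 1000000 + x * B ^ 4 ≤ B ^ 4 := by
    have e : 1000000 / B + (1000000 / B ^ 3 + (1000000 / B ^ 4 + x)) =
        (1000000 * B ^ 3 + 1000000 * B + 1000000 + x * B ^ 4) / B ^ 4 := by
      field_simp
      ring
    rw [e, div_le_one (pow_pos hB0 4)] at h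
    exact h
  have hB3 : B ^ 3 ≤ (1000000 + (1 / 10 ^ 6 + 1 / 10 ^ 12 + 3 / 10 ^ 18)) ^ 3 :=
    pow_le_pow_left₀ hB0.le (by linarith) 3
  have h2 : B ^ 3 * (B - 1000000) ≤
      (1000000 + (1 / 10 ^ 6 + 1 / 10 ^ 12 + 3 / 10 ^ 18)) ^ 3 * (1 / 10 ^ 6 + 1 / 10 ^ 12 + 3 / 10 ^ 18) :=
    mul_le_mul hB3 hd hd0 (by positivity)
  have hB4 : (1000000 : ℝ) ^ 4 ≤ B ^ 4 := pow_le_pow_left₀ (by norm_num) hlo 4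
  have h3 : (1 / 10 ^ 20 : ℝ) * 1000000 ^ 4 ≤ x * B ^ 4 := mul_le_mul hx hB4 (by norm_num) hx0
  have hYB : (1000000 : ℝ) * 1000000 ≤ 1000000 * B := mul_le_mul_of_nonneg_left hlo (by norm_num)
  have hnum : (1000000 + (1 / 10 ^ 6 + 1 / 10 ^ 12 + 3 / 10 ^ 18) : ℝ) ^ 3 * (1 / 10 ^ 6 + 1 / 10 ^ 12 + 3 / 10 ^ 18) -
      (1000000 * 1000000 + 1000000) < (1 / 10 ^ 20 : ℝ) * 1000000 ^ 4 := by norm_num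
  have e2 : B ^ 3 * (B - 1000000) = B ^ 4 - 1000000 * B ^ 3 := by ring
  rw [e2] at h2
  linarith

/-- A class term `y^a/β^{2b}` at `y = 10⁶` is at least `10^{6a}/1000001^b`. [cite: BeatonBousquetMelouDeGierDuminilCopinGuttmann2014, Section 3.1, Proposition 5] -/
private theorem class_term_ge_te (a b : ℕ) :
    (1000000 : ℝ) ^ a / 1000001 ^ b ≤ 1000000 ^ a / (wallRate 1000000 ^ 2) ^ b := by
  have hlo : (1000000 : ℝ) ≤ wallRate 1000000 ^ 2 := le_sq_wallRate_te (by norm_num)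
  have hhi : wallRate 1000000 ^ 2 ≤ 1000000 + 1 / 1000000 + 8748 / 1000000 ^ 2 := wallRate_sq_le_sharp (by norm_num)
  have hBhi : wallRate 1000000 ^ 2 ≤ 1000001 := by
    have : (1 : ℝ) / 1000000 + 8748 / 1000000 ^ 2 ≤ 1 := by norm_num
    linarith
  exact div_le_div_of_nonneg_left (by positivity) (pow_pos (by linarith) _) (pow_le_pow_left₀ (by linarith) hBhi b)

/-- The visit monomial is monotone in the number of visits at `y = 10⁶`. [cite: BeatonBousquetMelouDeGierDuminilCopinGuttmann2014, Section 3.1] -/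
private theorem pow_visits_ge_te {a v : ℕ} (hv : a ≤ v) (b : ℕ) :
    (1000000 : ℝ) ^ a / (wallRate 1000000 ^ 2) ^ b ≤ 1000000 ^ v / (wallRate 1000000 ^ 2) ^ b :=
  div_le_div_of_nonneg_right (pow_le_pow_right₀ (by norm_num) hv) (pow_nonneg (sq_nonneg _) _)

/-- The three known blocks at `y = 10⁶`: `y/β² ≤ f₁`, `f₃ = y/β⁶`, `f₄ = y/β⁸`. [cite: MadrasSlade1993, Section 4.2, (4.2.2) (p. 91)]
[cite: EntingJensen2009, Section 7.4.2, Fig. 7.10] -/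
private theorem known_blocks_te :
    1000000 / wallRate 1000000 ^ 2 ≤ pwbLaw 1000000 1 ∧ pwbLaw 1000000 3 = 1000000 / wallRate 1000000 ^ 6 ∧
      pwbLaw 1000000 4 = 1000000 / wallRate 1000000 ^ 8 :=
  ⟨div_sq_wallRate_le_pwbLaw_one_te (by norm_num), pwbLaw_three _, pwbLaw_four_eq _⟩

/-! ### §2  The order-three analytic census (symbolic lengths `m = 10, 12, 14`): `N₅₂ = N₆₃ = N₇₄ = 0`; with the entropy bound,
every irreducible block of half-length `s ≥ 5` has at most `s − 4` visits -/

/-- ★★ **Every irreducible positive wall bridge of length `10` has exactly one visit** (`N₅₂ = 0`: a class `(5,2)` would add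
`≥ y²/β¹⁰ ≈ 10⁻¹⁸ ≫ 10⁻²⁰` to Kesten's identity at `y = 10⁶`). [cite: MadrasSlade1993, Section 4.2, (4.2.4) and Theorem 4.2.2 (pp. 91–92)]
[cite: Kesten1963SAW, Section 4] -/
theorem visits_eq_one_of_mem_ipwb_ten {m : ℕ} (hm : m = 10) (hω : ω ∈ ipwb m) : visits m ω = 1 := by
  have hv := one_le_visits_te hω
  by_contra hne
  have hv2 : 2 ≤ visits m ω := by omega
  have hK := kesten_four_te mu_four_lt_Y_te (s := 5) (by norm_num) (by norm_num) (by norm_num)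
  obtain ⟨h1, h3, h4⟩ := known_blocks_te
  have hs := single_div_le_pwbLaw_te (y := 1000000) (s := 5) (n := m) (by norm_num) (by omega) hω
  have hx : (1 / 10 ^ 20 : ℝ) ≤ 1000000 ^ visits m ω / (wallRate 1000000 ^ 2) ^ 5 :=
    calc (1 / 10 ^ 20 : ℝ) ≤ 1000000 ^ 2 / 1000001 ^ 5 := by norm_num
      _ ≤ 1000000 ^ 2 / (wallRate 1000000 ^ 2) ^ 5 := class_term_ge_te 2 5
      _ ≤ _ := pow_visits_ge_te hv2 5
  refine no_room_te hx ?_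
  rw [← h3, ← h4]
  linarith

/-- ★★ **Every irreducible positive wall bridge of length `12` has at most two visits** (`N₆₃ = 0`: a class `(6,3)` would add `≥ y³/β¹² ≈ 10⁻¹⁸`).
[cite: MadrasSlade1993, Section 4.2, (4.2.4) and Theorem 4.2.2 (pp. 91–92)] [cite: Kesten1963SAW, Section 4] -/
theorem visits_le_two_of_mem_ipwb_twelve {m : ℕ} (hm : m = 12) (hω : ω ∈ ipwb m) : visits m ω ≤ 2 := by
  by_contra hne
  have hv3 : 3 ≤ visits m ω := by omega
  have hK := kesten_four_te mu_four_lt_Y_te (s := 6) (by norm_num) (by norm_num) (by norm_num)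
  obtain ⟨h1, h3, h4⟩ := known_blocks_te
  have hs := single_div_le_pwbLaw_te (y := 1000000) (s := 6) (n := m) (by norm_num) (by omega) hω
  have hx : (1 / 10 ^ 20 : ℝ) ≤ 1000000 ^ visits m ω / (wallRate 1000000 ^ 2) ^ 6 :=
    calc (1 / 10 ^ 20 : ℝ) ≤ 1000000 ^ 3 / 1000001 ^ 6 := by norm_num
      _ ≤ 1000000 ^ 3 / (wallRate 1000000 ^ 2) ^ 6 := class_term_ge_te 3 6
      _ ≤ _ := pow_visits_ge_te hv3 6
  refine no_room_te hx ?_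
  rw [← h3, ← h4]
  linarith

/-- ★★ **Every irreducible positive wall bridge of length `14` has at most three visits** (`N₇₄ = 0`: a class `(7,4)` would add `≥ y⁴/β¹⁴ ≈ 10⁻¹⁸`).
[cite: MadrasSlade1993, Section 4.2, (4.2.4) and Theorem 4.2.2 (pp. 91–92)] [cite: Kesten1963SAW, Section 4] -/
theorem visits_le_three_of_mem_ipwb_fourteen {m : ℕ} (hm : m = 14) (hω : ω ∈ ipwb m) : visits m ω ≤ 3 := by
  by_contra hne
  have hv4 : 4 ≤ visits m ω := by omega
  have hK := kesten_four_te mu_four_lt_Y_te (s := 7) (by norm_num) (by norm_num) (by norm_num)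
  obtain ⟨h1, h3, h4⟩ := known_blocks_te
  have hs := single_div_le_pwbLaw_te (y := 1000000) (s := 7) (n := m) (by norm_num) (by omega) hω
  have hx : (1 / 10 ^ 20 : ℝ) ≤ 1000000 ^ visits m ω / (wallRate 1000000 ^ 2) ^ 7 :=
    calc (1 / 10 ^ 20 : ℝ) ≤ 1000000 ^ 4 / 1000001 ^ 7 := by norm_num
      _ ≤ 1000000 ^ 4 / (wallRate 1000000 ^ 2) ^ 7 := class_term_ge_te 4 7
      _ ≤ _ := pow_visits_ge_te hv4 7
  refine no_room_te hx ?_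
  rw [← h3, ← h4]
  linarith

/-- ★★ **Third-order visit deficiency**: every irreducible positive wall bridge of length `n ≥ 10` has at most `n/2 − 4` visits
(`2·visits + 8 ≤ n`): the census for `n = 10, 12, 14`, the entropy bound `4·visits ≤ n + 2` for `n ≥ 16` (lengths are even).
[cite: MadrasSlade1993, Section 4.2, (4.2.4) and Theorem 4.2.2 (pp. 91–92)] [cite: Kesten1963SAW, Section 4] [cite: EntingJensen2009, Section 7.4.2, Fig. 7.10] -/
theorem two_mul_visits_add_eight_le (hn : 10 ≤ n) (hω : ω ∈ ipwb n) : 2 * visits n ω + 8 ≤ n := by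
  have hev := even_len_te hω
  by_cases h10 : n = 10
  · have := visits_eq_one_of_mem_ipwb_ten h10 hω; omega
  by_cases h12 : n = 12
  · have := visits_le_two_of_mem_ipwb_twelve h12 hω; omega
  by_cases h14 : n = 14
  · have := visits_le_three_of_mem_ipwb_fourteen h14 hω; omega
  have h16 : 16 ≤ n := by omega
  have h4 := four_mul_visits_le hω
  omega

/-- `visits ≤ n/2 − 4` on `ipwb n`, `n ≥ 10`. [cite: MadrasSlade1993, Section 4.2, (4.2.4) (p. 91)] -/
theorem visits_le_half_sub_four (hn : 10 ≤ n) (hω : ω ∈ ipwb n) : visits n ω ≤ n / 2 - 4 := by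
  have := two_mul_visits_add_eight_le hn hω
  omega

/-! ### §3  The irreducible polynomials `Λ₁₀ = N₅₁·y`, `Λ₁₂ ≤ N₆·y²`, `Λ₁₄ ≤ N₇·y³` and the block laws `f₅, f₆, f₇` -/

/-- ★★ `Λ₁₀(y) = #(ipwb 10)·y` (every block of length ten has one visit; symbolic length). [cite: MadrasSlade1993, Section 4.2, (4.2.2) (p. 91)] -/
theorem IPWB_ten {m : ℕ} (hm : m = 10) (y : ℝ) : IPWB m y = #(ipwb m) * y := by
  rw [IPWB, Finset.sum_congr rfl fun ω hω => by rw [visits_eq_one_of_mem_ipwb_ten hm hω, pow_one], Finset.sum_const,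
    nsmul_eq_mul]

/-- ★★ `f₅(y) = #(ipwb 10)·y/β(y)¹⁰` (symbolic length). [cite: MadrasSlade1993, Section 4.2, (4.2.2), (4.2.4) (p. 91)] -/
theorem pwbLaw_five {m : ℕ} (hm : m = 10) (y : ℝ) : pwbLaw y 5 = #(ipwb m) * y / wallRate y ^ 10 := by
  have e : pwbLaw y 5 = IPWB m y / wallRate y ^ m := by rw [pwbLaw, hm]
  rw [e, IPWB_ten hm, hm]

/-- `Λ_n(y) ≤ #(ipwb n)·y^{n/2 − 4}` for `n ≥ 10`, `y ≥ 1`. [cite: MadrasSlade1993, Section 4.2, (4.2.2) (p. 91)] -/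
theorem IPWB_le_card_mul_pow (hn : 10 ≤ n) (hy : 1 ≤ y) : IPWB n y ≤ #(ipwb n) * y ^ (n / 2 - 4) := by
  rw [IPWB]
  have h := Finset.sum_le_card_nsmul (ipwb n) (fun ω => y ^ visits n ω) (y ^ (n / 2 - 4)) fun ω hω =>
    pow_le_pow_right₀ hy (visits_le_half_sub_four hn hω)
  rwa [nsmul_eq_mul] at h

/-- `Λ₁₂(y) ≤ #(ipwb 12)·y²` (`y ≥ 1`; symbolic length). [cite: MadrasSlade1993, Section 4.2, (4.2.2) (p. 91)] -/
theorem IPWB_twelve_le {m : ℕ} (hm : m = 12) (hy : 1 ≤ y) : IPWB m y ≤ #(ipwb m) * y ^ 2 := by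
  have h := IPWB_le_card_mul_pow (n := m) (by omega) hy
  rwa [show m / 2 - 4 = 2 by omega] at h

/-- `Λ₁₄(y) ≤ #(ipwb 14)·y³` (`y ≥ 1`; symbolic length). [cite: MadrasSlade1993, Section 4.2, (4.2.2) (p. 91)] -/
theorem IPWB_fourteen_le {m : ℕ} (hm : m = 14) (hy : 1 ≤ y) : IPWB m y ≤ #(ipwb m) * y ^ 3 := by
  have h := IPWB_le_card_mul_pow (n := m) (by omega) hy
  rwa [show m / 2 - 4 = 3 by omega] at h

/-- ★ `f_s(y) ≤ #(ipwb 2s)/y⁴` for `s ≥ 5`, `y ≥ 1` (`Λ_{2s} ≤ N·y^{s−4}`, `β^{2s} ≥ y^s`; symbolic length `m = 2s`).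
[cite: MadrasSlade1993, Section 4.2, (4.2.2), (4.2.4) (p. 91)] [cite: BeatonBousquetMelouDeGierDuminilCopinGuttmann2014, Section 3.1, Proposition 5] -/
theorem pwbLaw_le_card_div_pow_four {m s : ℕ} (hm : m = 2 * s) (hs : 5 ≤ s) (hy : 1 ≤ y) : pwbLaw y s ≤ #(ipwb m) / y ^ 4 := by
  have hy0 : 0 < y := by linarith
  have e : pwbLaw y s = IPWB m y / wallRate y ^ m := by rw [pwbLaw, hm]
  rw [e]
  have hden : y ^ s ≤ wallRate y ^ m := by rw [hm]; exact pow_le_wallRate_pow_te hy0 s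
  calc IPWB m y / wallRate y ^ m ≤ #(ipwb m) * y ^ (m / 2 - 4) / wallRate y ^ m :=
        div_le_div_of_nonneg_right (IPWB_le_card_mul_pow (by omega) hy) (pow_nonneg (wallRate_pos y).le m)
    _ ≤ #(ipwb m) * y ^ (m / 2 - 4) / y ^ s := div_le_div_of_nonneg_left (by positivity) (by positivity) hden
    _ = #(ipwb m) / y ^ 4 := by
        rw [show m / 2 - 4 = s - 4 by omega, div_eq_div_iff (by positivity) (by positivity)]
        rw [show (#(ipwb m) : ℝ) * y ^ (s - 4) * y ^ 4 = #(ipwb m) * (y ^ (s - 4) * y ^ 4) by ring, ← pow_add,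
          show s - 4 + 4 = s by omega]

/-- ★ `f_s(y) ≤ 9^s/y⁴` for `s ≥ 5`, `y ≥ 1` (`#(ipwb 2s) ≤ 3^{2s}`). [cite: MadrasSlade1993, Section 1.2, (1.2.3); Section 4.2, (4.2.2) (p. 91)] -/
theorem pwbLaw_le_nine_pow_div {s : ℕ} (hs : 5 ≤ s) (hy : 1 ≤ y) : pwbLaw y s ≤ 9 ^ s / y ^ 4 := by
  obtain ⟨m, hm⟩ : ∃ m : ℕ, m = 2 * s := ⟨_, rfl⟩
  have h := pwbLaw_le_card_div_pow_four hm hs hy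
  have hc : (#(ipwb m) : ℝ) ≤ 9 ^ s := by
    calc (#(ipwb m) : ℝ) ≤ 3 ^ m := card_ipwb_le_three_pow m
      _ = 9 ^ s := by rw [hm, pow_mul]; norm_num
  exact h.trans (div_le_div_of_nonneg_right hc (by positivity))

/-- ★ **The three order-four head terms are `O(y⁻⁴)`**: `4f₅ + 5f₆ + 6f₇ ≤ 31591215/y⁴` (`= (4·9⁵ + 5·9⁶ + 6·9⁷)/y⁴`) for `y ≥ 1`.
[cite: MadrasSlade1993, Section 4.2, (4.2.2)–(4.2.5) (p. 91)] -/
theorem head_four_mul_pwbLaw_le (hy : 1 ≤ y) : 4 * pwbLaw y 5 + 5 * pwbLaw y 6 + 6 * pwbLaw y 7 ≤ 31591215 / y ^ 4 := by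
  have h5 := pwbLaw_le_nine_pow_div (s := 5) (by norm_num) hy
  have h6 := pwbLaw_le_nine_pow_div (s := 6) (by norm_num) hy
  have h7 := pwbLaw_le_nine_pow_div (s := 7) (by norm_num) hy
  have e : (31591215 : ℝ) / y ^ 4 = 4 * (9 ^ 5 / y ^ 4) + 5 * (9 ^ 6 / y ^ 4) + 6 * (9 ^ 7 / y ^ 4) := by norm_num; ring
  rw [e]
  linarith

/-! ### §4  The excess beyond half-length seven and its envelope bound -/

/-- **Excess decomposition at order three**: for `y > μ⁴`, `Σ_{j ≥ 0} (j + 7) f_{j+8}(y) = m(y) − 1 − (2f₃ + 3f₄ + 4f₅ + 5f₆ + 6f₇)`.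
[cite: MadrasSlade1993, Section 4.2, (4.2.4)–(4.2.5) and Theorem 4.2.2 (pp. 91–92)] [cite: Feller1968, XIII.3] -/
theorem hasSum_excess_tail_eight (hy : hexConnectiveConstant ^ 4 < y) :
    HasSum (fun j : ℕ => ((j : ℝ) + 7) * pwbLaw y (j + 8))
      (pwbMean y - 1 - (2 * pwbLaw y 3 + 3 * pwbLaw y 4 + 4 * pwbLaw y 5 + 5 * pwbLaw y 6 + 6 * pwbLaw y 7)) := by
  have ht := (hasSum_nat_add_iff' 2).2 (hasSum_excess_tail hy)
  have hsum : ∑ i ∈ Finset.range 2, ((i : ℝ) + 5) * pwbLaw y (i + 6) = 5 * pwbLaw y 6 + 6 * pwbLaw y 7 := by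
    simp only [Finset.sum_range_succ, Finset.sum_range_zero]
    push_cast
    ring
  rw [hsum] at ht
  have e : pwbMean y - 1 - (2 * pwbLaw y 3 + 3 * pwbLaw y 4 + 4 * pwbLaw y 5 + 5 * pwbLaw y 6 + 6 * pwbLaw y 7) =
      pwbMean y - 1 - (2 * pwbLaw y 3 + 3 * pwbLaw y 4 + 4 * pwbLaw y 5) - (5 * pwbLaw y 6 + 6 * pwbLaw y 7) := by ring
  rw [e]
  refine ht.congr_fun fun j => ?_
  rw [show j + 2 + 6 = j + 8 by omega]
  push_cast
  ring

/-- `θ = μ²/√y ≤ ½` once `y ≥ 48` (`4μ⁴ < 48`). [cite: MadrasSlade1993, Section 4.2, remark before (4.2.21) (p. 94)] [cite: DuminilCopinSmirnov2012, Theorem 1] -/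
private theorem theta_le_half_te (hy : 48 ≤ y) : hexConnectiveConstant ^ 2 / Real.sqrt y ≤ 1 / 2 := by
  have hy0 : 0 < y := by linarith
  have hs0 : 0 < Real.sqrt y := Real.sqrt_pos.2 hy0
  have hy2 : Real.sqrt y ^ 2 = y := Real.sq_sqrt hy0.le
  have h4 : (2 * hexConnectiveConstant ^ 2) ^ 2 ≤ Real.sqrt y ^ 2 := by
    rw [hy2]
    have e : (2 * hexConnectiveConstant ^ 2) ^ 2 = 4 * hexConnectiveConstant ^ 4 := by ring
    rw [e]
    have := mu_four_lt_twelve_te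
    linarith
  have h2 : 2 * hexConnectiveConstant ^ 2 ≤ Real.sqrt y :=
    (pow_le_pow_iff_left₀ (by positivity) hs0.le two_ne_zero).1 h4
  rw [div_le_iff₀ hs0]
  linarith

/-- ★★ **Tail bound at order three**: for `y ≥ 48`, `m(y) − 1 − (2f₃ + 3f₄ + 4f₅ + 5f₆ + 6f₇) ≤ 16 μ¹⁸/(y³√y)` (envelope `f_s ≤ μ²√y θ^s`,
`θ = μ²/√y ≤ ½`, `Σ_j (j + 7)θ^j = θ/(1 − θ)² + 7/(1 − θ) ≤ 16`, prefactor `μ²√y θ⁸ = μ¹⁸/(y³√y)`).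
[cite: MadrasSlade1993, Section 4.2, Theorem 4.2.2 and remark before (4.2.21) (pp. 91–94)] [cite: Feller1968, XIII.3] -/
theorem excess_tail_eight_le (hy : 48 ≤ y) :
    pwbMean y - 1 - (2 * pwbLaw y 3 + 3 * pwbLaw y 4 + 4 * pwbLaw y 5 + 5 * pwbLaw y 6 + 6 * pwbLaw y 7) ≤
      16 * hexConnectiveConstant ^ 18 / (y ^ 3 * Real.sqrt y) := by
  have hy0 : 0 < y := by linarith
  have hy1 : 1 ≤ y := by linarith
  have hμ : hexConnectiveConstant ^ 4 < y := mu_four_lt_twelve_te.trans_le (by linarith)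
  have hθhalf := theta_le_half_te hy
  have hs0 : 0 < Real.sqrt y := Real.sqrt_pos.2 hy0
  have hμ2 : 0 < hexConnectiveConstant ^ 2 := pow_pos hexConnectiveConstant_pos 2
  have hθ0 : 0 < hexConnectiveConstant ^ 2 / Real.sqrt y := div_pos hμ2 hs0
  have hθ1 : hexConnectiveConstant ^ 2 / Real.sqrt y < 1 := by linarith
  have ht := hasSum_excess_tail_eight hμ
  have hG1 : HasSum (fun j : ℕ => (j : ℝ) * (hexConnectiveConstant ^ 2 / Real.sqrt y) ^ j)
      ((hexConnectiveConstant ^ 2 / Real.sqrt y) / (1 - hexConnectiveConstant ^ 2 / Real.sqrt y) ^ 2) :=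
    hasSum_coe_mul_geometric_of_norm_lt_one (by rw [Real.norm_of_nonneg hθ0.le]; exact hθ1)
  have hG0 : HasSum (fun j : ℕ => (hexConnectiveConstant ^ 2 / Real.sqrt y) ^ j)
      (1 - hexConnectiveConstant ^ 2 / Real.sqrt y)⁻¹ := hasSum_geometric_of_lt_one hθ0.le hθ1
  have hG : HasSum (fun j : ℕ => ((j : ℝ) + 7) *
      (hexConnectiveConstant ^ 2 * Real.sqrt y * (hexConnectiveConstant ^ 2 / Real.sqrt y) ^ (j + 8)))
      (hexConnectiveConstant ^ 2 * Real.sqrt y * (hexConnectiveConstant ^ 2 / Real.sqrt y) ^ 8 *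
        ((hexConnectiveConstant ^ 2 / Real.sqrt y) / (1 - hexConnectiveConstant ^ 2 / Real.sqrt y) ^ 2 +
          7 * (1 - hexConnectiveConstant ^ 2 / Real.sqrt y)⁻¹)) := by
    have h := (hG1.add (hG0.mul_left 7)).mul_left
      (hexConnectiveConstant ^ 2 * Real.sqrt y * (hexConnectiveConstant ^ 2 / Real.sqrt y) ^ 8)
    exact h.congr_fun fun j => by ring
  have hle := hasSum_le (fun j => mul_le_mul_of_nonneg_left (pwbLaw_le_geom hy1 (j + 8)) (by positivity)) ht hG
  -- the numerical factor `θ/(1 − θ)² + 7/(1 − θ) ≤ 2 + 14 = 16` for `θ ≤ ½`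
  set θ := hexConnectiveConstant ^ 2 / Real.sqrt y with hθ_def
  have h1θ : 1 / 2 ≤ 1 - θ := by linarith
  have hinv : (1 - θ)⁻¹ ≤ 2 := by
    rw [inv_le_comm₀ (by linarith) (by norm_num)]
    linarith
  have hq : 1 / 4 ≤ (1 - θ) ^ 2 := by nlinarith
  have hdiv : θ / (1 - θ) ^ 2 ≤ 2 := by
    rw [div_le_iff₀ (by positivity)]
    linarith
  have hsum : θ / (1 - θ) ^ 2 + 7 * (1 - θ)⁻¹ ≤ 16 := by linarith
  -- the prefactor `μ²√y θ⁸ = μ¹⁸/(y³√y)`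
  set s := Real.sqrt y with hs_def
  have hys : y = s ^ 2 := (Real.sq_sqrt hy0.le).symm
  have hE0 : 0 ≤ hexConnectiveConstant ^ 2 * s * θ ^ 8 := by positivity
  have hEθ : hexConnectiveConstant ^ 2 * s * θ ^ 8 = hexConnectiveConstant ^ 18 / (y ^ 3 * s) := by
    rw [show y ^ 3 * s = s ^ 7 by rw [hys]; ring, hθ_def, div_pow, ← mul_div_assoc,
      div_eq_div_iff (pow_ne_zero 8 hs0.ne') (pow_ne_zero 7 hs0.ne')]
    ring
  calc pwbMean y - 1 - (2 * pwbLaw y 3 + 3 * pwbLaw y 4 + 4 * pwbLaw y 5 + 5 * pwbLaw y 6 + 6 * pwbLaw y 7)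
      ≤ hexConnectiveConstant ^ 2 * s * θ ^ 8 * (θ / (1 - θ) ^ 2 + 7 * (1 - θ)⁻¹) := hle
    _ ≤ hexConnectiveConstant ^ 2 * s * θ ^ 8 * 16 := mul_le_mul_of_nonneg_left hsum hE0
    _ = 16 * hexConnectiveConstant ^ 18 / (y ^ 3 * s) := by rw [hEθ]; ring

/-- ★★ **Upper bound at order three** (`y ≥ 48`): `y³ (m(y) − 1 − 2y/β⁶) ≤ 3·(y⁴/β⁸) + 31591215/y + 16 μ¹⁸/√y` — exact `f₃, f₄`,
the census bound `4f₅ + 5f₆ + 6f₇ ≤ 31591215/y⁴`, the tail. [cite: MadrasSlade1993, Section 4.2, (4.2.2)–(4.2.5) and Theorem 4.2.2 (pp. 91–92)]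
[cite: Kesten1963SAW, Section 4] -/
theorem cube_mul_pwbMean_sub_one_sub_le (hy : 48 ≤ y) :
    y ^ 3 * (pwbMean y - 1 - 2 * y / wallRate y ^ 6) ≤
      3 * (y ^ 4 / wallRate y ^ 8) + 31591215 / y + 16 * hexConnectiveConstant ^ 18 / Real.sqrt y := by
  have hy0 : 0 < y := by linarith
  have hy1 : 1 ≤ y := by linarith
  have hs0 : 0 < Real.sqrt y := Real.sqrt_pos.2 hy0
  have ht := excess_tail_eight_le hy
  have hh := head_four_mul_pwbLaw_le hy1
  rw [pwbLaw_three, pwbLaw_four_eq] at ht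
  have hle : pwbMean y - 1 - 2 * y / wallRate y ^ 6 ≤
      3 * (y / wallRate y ^ 8) + 31591215 / y ^ 4 + 16 * hexConnectiveConstant ^ 18 / (y ^ 3 * Real.sqrt y) := by
    have e2 : 2 * y / wallRate y ^ 6 = 2 * (y / wallRate y ^ 6) := by ring
    linarith
  have hm := mul_le_mul_of_nonneg_left hle (pow_pos hy0 3).le
  have e1 : y ^ 3 * (3 * (y / wallRate y ^ 8)) = 3 * (y ^ 4 / wallRate y ^ 8) := by ring
  have e2 : y ^ 3 * (31591215 / y ^ 4) = 31591215 / y := by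
    rw [mul_div_assoc', div_eq_div_iff (by positivity) (by positivity)]; ring
  have e3 : y ^ 3 * (16 * hexConnectiveConstant ^ 18 / (y ^ 3 * Real.sqrt y)) = 16 * hexConnectiveConstant ^ 18 / Real.sqrt y := by
    rw [mul_div_assoc', div_eq_div_iff (by positivity) (by positivity)]; ring
  calc y ^ 3 * (pwbMean y - 1 - 2 * y / wallRate y ^ 6)
      ≤ y ^ 3 * (3 * (y / wallRate y ^ 8) + 31591215 / y ^ 4 + 16 * hexConnectiveConstant ^ 18 / (y ^ 3 * Real.sqrt y)) := hm
    _ = 3 * (y ^ 4 / wallRate y ^ 8) + 31591215 / y + 16 * hexConnectiveConstant ^ 18 / Real.sqrt y := by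
        rw [mul_add, mul_add, e1, e2, e3]

/-- ★ The order-three window (`y ≥ 48`): `3·(y⁴/β⁸) ≤ y³ (m(y) − 1 − 2y/β⁶) ≤ 3·(y⁴/β⁸) + 31591215/y + 16 μ¹⁸/√y`.
[cite: MadrasSlade1993, Section 4.2, (4.2.5) and Theorem 4.2.2 (pp. 91–92)] -/
theorem cube_mul_pwbMean_sub_one_sub_mem_Icc (hy : 48 ≤ y) :
    y ^ 3 * (pwbMean y - 1 - 2 * y / wallRate y ^ 6) ∈
      Set.Icc (3 * (y ^ 4 / wallRate y ^ 8)) (3 * (y ^ 4 / wallRate y ^ 8) + 31591215 / y + 16 * hexConnectiveConstant ^ 18 / Real.sqrt y) :=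
  ⟨three_mul_le_cube_mul (mu_four_lt_twelve_te.trans_le (by linarith)), cube_mul_pwbMean_sub_one_sub_le hy⟩

/-! ### §5  THE THIRD-ORDER LIMIT `y³ (m(y) − 1 − 2y/β(y)⁶) → 3` and `m(y) = 1 + 2/y² + 3/y³ + o(y⁻³)` -/

/-- ★★★ **`y³ (m(y) − 1 − 2y/β(y)⁶) → 3`** (`y → ∞`): the flat excursion (`N₄₁ = 1`, `f₄ = y/β⁸ ∼ y⁻³`) carries the WHOLE third
order of the renewal mean — the blocks of half-length `5, 6, 7` are `O(y⁻⁴)` by the census and the rest is `O(y^{-7/2})` by the envelope;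
this is the limit `L` of «THIRD-LOWER-MEAN»'s `three_le_of_tendsto_cube_mul`, now shown to EXIST and to equal `3`.
[cite: MadrasSlade1993, Section 4.2, (4.2.5) and Theorem 4.2.2 (pp. 91–92)] [cite: Kesten1963SAW, Section 4] [cite: JansevanRensburg2000, Section 3.3.2, Lemma 3.20] -/
theorem tendsto_cube_mul_pwbMean_sub_one_sub :
    Tendsto (fun y : ℝ => y ^ 3 * (pwbMean y - 1 - 2 * y / wallRate y ^ 6)) atTop (𝓝 3) := by
  have h0 : Tendsto (fun y : ℝ => 3 * (y ^ 4 / wallRate y ^ 8)) atTop (𝓝 3) := by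
    simpa using tendsto_pow_four_div_wallRate_pow_eight.const_mul 3
  have h1 : Tendsto (fun y : ℝ => (31591215 : ℝ) / y) atTop (𝓝 0) := tendsto_const_nhds.div_atTop tendsto_id
  have h2 : Tendsto (fun y : ℝ => 16 * hexConnectiveConstant ^ 18 / Real.sqrt y) atTop (𝓝 0) :=
    tendsto_const_nhds.div_atTop Real.tendsto_sqrt_atTop
  have hup : Tendsto (fun y : ℝ => 3 * (y ^ 4 / wallRate y ^ 8) + 31591215 / y + 16 * hexConnectiveConstant ^ 18 / Real.sqrt y)
      atTop (𝓝 3) := by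
    simpa using (h0.add h1).add h2
  refine tendsto_of_tendsto_of_tendsto_of_le_of_le' h0 hup ?_ ?_
  · filter_upwards [eventually_gt_atTop (hexConnectiveConstant ^ 4)] with y hy
    exact three_mul_le_cube_mul hy
  · filter_upwards [eventually_ge_atTop (48 : ℝ)] with y hy
    exact cube_mul_pwbMean_sub_one_sub_le hy

/-- **The dip term to third order**: `2y − 52494/y ≤ y³·(2y/β(y)⁶) ≤ 2y` for `y ≥ 1` (`y ≤ β² ≤ y + 8749/y`: with `r = y/β² ∈ (0,1]`,
`y³·2y/β⁶ = 2y r³` and `1 − r ≤ 8749/y²`), i.e. `2y/β⁶ = 2/y² + O(y⁻⁴)`. [cite: BeatonBousquetMelouDeGierDuminilCopinGuttmann2014, Section 3.1, Proposition 5 (arXiv v5 p. 9)]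
[cite: MadrasSlade1993, Section 4.2, (4.2.2) (p. 91)] -/
theorem cube_mul_two_mul_div_window (hy : 1 ≤ y) :
    2 * y - 52494 / y ≤ y ^ 3 * (2 * y / wallRate y ^ 6) ∧ y ^ 3 * (2 * y / wallRate y ^ 6) ≤ 2 * y := by
  have hy0 : 0 < y := by linarith
  have e6 : wallRate y ^ 6 = (wallRate y ^ 2) ^ 3 := by rw [← pow_mul]
  rw [e6]
  set B := wallRate y ^ 2 with hB
  have hlo : y ≤ B := le_sq_wallRate_te hy0
  have hhi : B ≤ y + 8749 / y := wallRate_sq_le_add_div hy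
  have hB0 : 0 < B := by linarith
  set r := y / B with hr
  have hr0 : 0 < r := div_pos hy0 hB0
  have hr1 : r ≤ 1 := (div_le_one hB0).2 hlo
  have h1r : 1 - r ≤ 8749 / y ^ 2 := by
    rw [hr, one_sub_div hB0.ne', div_le_iff₀ hB0]
    have h' : 8749 / y ≤ 8749 / y ^ 2 * B :=
      calc (8749 : ℝ) / y = 8749 / y ^ 2 * y := by field_simp
        _ ≤ 8749 / y ^ 2 * B := mul_le_mul_of_nonneg_left hlo (by positivity)
    linarith
  have e : y ^ 3 * (2 * y / B ^ 3) = 2 * y * r ^ 3 := by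
    rw [hr, div_pow, mul_div_assoc', mul_div_assoc']
    ring
  rw [e]
  have hr3 : r ^ 3 ≤ 1 := pow_le_one₀ hr0.le hr1
  refine ⟨?_, by nlinarith⟩
  have e2 : 2 * y - 2 * y * r ^ 3 = 2 * y * (1 - r) * (1 + r + r ^ 2) := by ring
  have hq : 1 + r + r ^ 2 ≤ 3 := by nlinarith
  have hnn : 0 ≤ 2 * y * (1 - r) := mul_nonneg (by positivity) (by linarith)
  have h3 : 2 * y * (1 - r) * (1 + r + r ^ 2) ≤ 2 * y * (1 - r) * 3 := mul_le_mul_of_nonneg_left hq hnn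
  have h4 : 2 * y * (1 - r) * 3 ≤ 2 * y * (8749 / y ^ 2) * 3 :=
    mul_le_mul_of_nonneg_right (mul_le_mul_of_nonneg_left h1r (by positivity)) (by norm_num)
  have e3 : 2 * y * (8749 / y ^ 2) * 3 = 52494 / y := by
    field_simp
    ring
  linarith

/-- `y³·(2y/β(y)⁶) − 2y → 0`. [cite: BeatonBousquetMelouDeGierDuminilCopinGuttmann2014, Section 3.1, Proposition 5 (arXiv v5 p. 9)] -/
theorem tendsto_cube_mul_two_mul_div_sub : Tendsto (fun y : ℝ => y ^ 3 * (2 * y / wallRate y ^ 6) - 2 * y) atTop (𝓝 0) := by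
  have h1 : Tendsto (fun y : ℝ => -((52494 : ℝ) / y)) atTop (𝓝 (-0)) := (tendsto_const_nhds.div_atTop tendsto_id).neg
  rw [neg_zero] at h1
  refine tendsto_of_tendsto_of_tendsto_of_le_of_le' h1 tendsto_const_nhds ?_ ?_
  · filter_upwards [eventually_ge_atTop (1 : ℝ)] with y hy
    have h := (cube_mul_two_mul_div_window hy).1
    linarith
  · filter_upwards [eventually_ge_atTop (1 : ℝ)] with y hy
    have h := (cube_mul_two_mul_div_window hy).2
    linarith

/-- ★★★ **`y³ (m(y) − 1 − 2/y²) → 3`**, i.e. **`m(y) = 1 + 2/y² + 3/y³ + o(y⁻³)`** (`y → ∞`): the renewal mean of the positive-wall-bridge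
renewal structure to third order, with integer coefficients `2 = 2·N₃₁` (the dip) and `3 = 3·N₄₁` (the flat excursion).
[cite: MadrasSlade1993, Section 4.2, (4.2.5) and Theorem 4.2.2 (pp. 91–92)] [cite: Kesten1963SAW, Section 4] [cite: EntingJensen2009, Section 7.4.2, Fig. 7.10] -/
theorem tendsto_cube_mul_pwbMean_sub_one_sub_two_div_sq :
    Tendsto (fun y : ℝ => y ^ 3 * (pwbMean y - 1 - 2 / y ^ 2)) atTop (𝓝 3) := by
  have h := tendsto_cube_mul_pwbMean_sub_one_sub.add tendsto_cube_mul_two_mul_div_sub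
  rw [add_zero] at h
  refine h.congr' ?_
  filter_upwards [eventually_gt_atTop (0 : ℝ)] with y hy
  have hw : wallRate y ^ 6 ≠ 0 := pow_ne_zero 6 (wallRate_pos y).ne'
  have e : y ^ 3 * (2 / y ^ 2) = 2 * y := by
    rw [mul_div_assoc', div_eq_iff (by positivity)]; ring
  calc y ^ 3 * (pwbMean y - 1 - 2 * y / wallRate y ^ 6) + (y ^ 3 * (2 * y / wallRate y ^ 6) - 2 * y)
      = y ^ 3 * (pwbMean y - 1) - 2 * y := by ring
    _ = y ^ 3 * (pwbMean y - 1 - 2 / y ^ 2) := by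
        rw [show y ^ 3 * (pwbMean y - 1 - 2 / y ^ 2) = y ^ 3 * (pwbMean y - 1) - y ^ 3 * (2 / y ^ 2) by ring, e]

/-- ★ **Asymptotic equivalence** `m(y) − 1 − 2/y² ∼ 3/y³` (`y → ∞`). [cite: MadrasSlade1993, Section 4.2, Theorem 4.2.2 (pp. 91–92)] [cite: Kesten1963SAW, Section 4] -/
theorem isEquivalent_pwbMean_sub_one_sub_two_div_sq :
    (fun y : ℝ => pwbMean y - 1 - 2 / y ^ 2) ~[atTop] fun y : ℝ => 3 / y ^ 3 := by
  have hz : ∀ᶠ y : ℝ in atTop, (3 : ℝ) / y ^ 3 ≠ 0 := by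
    filter_upwards [eventually_gt_atTop (0 : ℝ)] with y hy
    positivity
  refine (isEquivalent_iff_tendsto_one hz).2 ?_
  have h := tendsto_cube_mul_pwbMean_sub_one_sub_two_div_sq.div_const 3
  rw [show ((3 : ℝ) / 3) = 1 by norm_num] at h
  refine h.congr' ?_
  filter_upwards [eventually_gt_atTop (0 : ℝ)] with y hy
  simp only [Pi.div_apply]
  rw [div_div_eq_mul_div]
  ring

/-- ★ For every `a > 3`, eventually `y³ (m(y) − 1 − 2y/β⁶) ≤ a` (the matching upper companion of «THIRD-LOWER-MEAN»'s
`eventually_le_cube_mul_pwbMean`). [cite: MadrasSlade1993, Section 4.2, (4.2.5) (p. 91)] -/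
theorem eventually_cube_mul_pwbMean_le {a : ℝ} (ha : 3 < a) :
    ∀ᶠ y : ℝ in atTop, y ^ 3 * (pwbMean y - 1 - 2 * y / wallRate y ^ 6) ≤ a :=
  (tendsto_cube_mul_pwbMean_sub_one_sub.eventually (eventually_le_nhds ha))

end Literature.Probability.RandomPlanarGeometry.SAW.HexBW.Wall
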